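/-
Copyright (c) 2026. All rights reserved.
Released under Apache 2.0 license as described in the file LICENSE.
-/
import Literature.Geometry.Kaehler.ComplexTorusQuaternionXSixSpecialCyclesDegreeStructure
import Literature.Geometry.Kaehler.ComplexTorusQuaternionXSixSpecialCyclesContentCounts
import Literature.Geometry.Kaehler.ComplexTorusQuaternionXSixSpecialCyclesPointCount
import Mathlib.NumberTheory.Padics.PadicVal.Basic
import HarnessLib

/-!
# A closed form for the degree on the vector side, for EVERY `t > 0`:
# `deg Z(t)_ℚ = |L(t)/O₆^×| − [t is a square] − (4/3)·[t/3 is a square]` = #(points) − (elliptic corrections)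

Kudla–Rapoport–Yang's (3.4.14) `deg Z(t)_ℚ = 2·Σ_{x ∈ L(t) mod Γ} e_x⁻¹` (`Γ = O_B^× = O₆^×`, `e_x = |Γ_x|`; `D(B) = 6`,
`B = (−1,3)_ℚ`) was reduced in `…XSixSpecialCyclesDegreeStructure` to the content strata:
`Σᶠ_{L(t)/O₆^×} e⁻¹ = Σ_{c=1}^{t} |L_c(t)/O₆^×| / w_c(t)`, `w_c(t) = 4, 6, 2` according as `t = c²`, `t = 3c²`, or else
(`L_c(t)` = primitive `p` with `c²Q(p) = t`). Only TWO strata can have a weight `≠ 2`: the stratum `c = m` when `t = m²`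
(primitive part of norm `1`: `Γ_x = ℤ[i]^×`, the order-`2` elliptic points) and `c = m` when `t = 3m²` (norm `3`: `ℤ[ζ₃]^×`,
order `3`), and each of them has exactly `|L(1)/O₆^×| = |L(3)/O₆^×| = 2` classes. Since `|L(t)/O₆^×| = Σ_c |L_c(t)/O₆^×|`
(`card_unit_classes_eq_sum_content`), the degree has a CLOSED FORM in the class number `|L(t)/O₆^×|` = the number
`#(Pt(t)/Γ₆)` of points of `X₆` under `Z(t)` (`card_specialPoints_eq_card_unit_classes`), valid for every `t > 0`:

* `card_stratum_of_sq_eq`, `card_stratum_of_three_mul_sq_eq` (§1): the strata `t = c²` and `t = 3c²` have `2` classes each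
  (they ARE `L(1)/O₆^×` and `L(3)/O₆^×`: a vector of norm `1` or `3` is primitive).
* `two_mul_finsum_eq_card_sub` (§2): **`2·Σᶠ_{L(t)/O₆^×} e⁻¹ = |L(t)/O₆^×| − ½·Σ_{c ≤ t, c² = t} |L_c(t)/O₆^×| −
  ⅔·Σ_{c ≤ t, 3c² = t} |L_c(t)/O₆^×|`** (`t > 0`).
* `degree_eq_card_of_not_sq` (§2): **`t` neither a square nor `3·`square ⟹ `deg Z(t)_ℚ = |L(t)/O₆^×| = #(Pt(t)/Γ₆)`** — every
  point of the support counts with weight `1` (all stabilisers are `±1`).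
* `degree_eq_card_sub_one_of_sq` (§2): **`t = m²` ⟹ `deg Z(t)_ℚ = |L(t)/O₆^×| − 1`** (the two classes `[±m·i]` over the order-`2`
  elliptic points weigh `½` each; `m² = 3c²` is impossible, `sq_ne_three_mul_sq`, by the `3`-adic valuation).
* `degree_eq_card_sub_of_three_mul_sq` (§2): **`t = 3m²` ⟹ `deg Z(t)_ℚ = |L(t)/O₆^×| − 4/3`** (the two classes over the
  order-`3` elliptic points weigh `⅓` each).
* §3: the same three statements with `#(Pt(t)/Γ₆)`, the number of points of `Z(t)` on `X₆`; in particular `deg Z(t)_ℚ` is an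
  integer unless `t/3` is a square (`degree_add_den`: `3·deg ∈ ℤ` always). Checks against the table of `…DegreeValues`:
  `t = 25`: `6 − 1 = 5`; `t = 75`: `6 − 4/3 = 14/3`; `t = 13`: `4`; `t = 36`: `2 − 1 = 1`.

## Sources

* [KRY] S. Kudla, M. Rapoport, T. Yang, *Modular Forms and Special Cycles on Shimura Curves*, Ann. of Math. Stud. 161
  (2006), §3.4 (3.4.4)–(3.4.6) («`w(c²d)` is the number of units in `O_{c²d}`» — `4`, `6` or `2`), (3.4.13)–(3.4.14), Remark
  3.4.4, Prop. 3.4.5. [cite: KudlaRapoportYang2006, §3.4 (3.4.4)–(3.4.6), (3.4.13)–(3.4.14)]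
* [Vignéras] M.-F. Vignéras, *Arithmétique des algèbres de quaternions*, LNM 800 (1980), Ch. IV §1–§2 (elliptic points of
  `𝒪¹` ↔ embeddings of `ℤ[i]`, `ℤ[ζ₃]`) and Ch. III §5.C Cor. 5.12–5.14. [cite: VignerasLNM800, Ch. IV §1–§2; Ch. III §5.C]
* [BT] P. Bayer, A. Travesa (2007), §1 Thm. 1.1 (the elliptic points of `X₆`: two of order `2`, two of order `3`).
  [cite: BayerTravesa2007, §1 Thm. 1.1]

## Scope (honest)

Theorems only — no definitions, no named facts, no instances; everything is stated on the inline quotients of the series. The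
closed form is in terms of the class number `|L(t)/O₆^×|`, which is NOT evaluated in general here (Eichler's theorem, cf.
`…XSixSpecialCyclesEichlerClassNumbers` for twelve values).
-/

set_option maxSynthPendingDepth 3

open Quaternion Function Literature.NumberTheory.QuadraticFields.Quadratic

namespace Literature.Geometry.Kaehler.ComplexTorus.QuaternionType

/-! ## §0 Helpers -/

section Helpers

/-- **`m² ≠ 3c²` for `c ≥ 1`** (`√3 ∉ ℚ`: the `3`-adic valuation of `m²` is even, that of `3c²` odd). [folklore] -/
private theorem sq_ne_three_mul_sq₄₂ {m c : ℕ} (hc : 0 < c) : m ^ 2 ≠ 3 * c ^ 2 := by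
  intro h
  have hm : m ≠ 0 := by
    rintro rfl
    have : c ^ 2 = 0 := by omega
    exact hc.ne' (pow_eq_zero_iff two_ne_zero |>.1 this)
  have h1 := congrArg (padicValNat 3) h
  rw [padicValNat.pow, padicValNat.mul (by norm_num) (pow_ne_zero 2 hc.ne'), padicValNat.pow, padicValNat_self] at h1
  omega

/-- The same over `ℤ` for a natural `c ≥ 1` and an integer `m`. [folklore] -/
private theorem intSq_ne_three_mul_sq₄₂ {c : ℕ} (hc : 0 < c) (m : ℤ) : m ^ 2 ≠ 3 * (c : ℤ) ^ 2 := by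
  intro h
  have h' : (m.natAbs : ℤ) ^ 2 = 3 * (c : ℤ) ^ 2 := by rw [Int.natAbs_sq, h]
  have h'' : m.natAbs ^ 2 = 3 * c ^ 2 := by exact_mod_cast h'
  exact sq_ne_three_mul_sq₄₂ hc h''

/-- `c ∈ [1, t]` when `c ≥ 1` and `c²·Q = t > 0` with `Q ≥ 1`. [folklore] -/
private theorem mem_Icc_of_sq_mul₄₂ {t : ℤ} (ht : 0 < t) {c : ℕ} (hc : 0 < c) {Qx : ℤ} (hQ : 0 < Qx)
    (e : (c : ℤ) ^ 2 * Qx = t) : c ∈ Finset.Icc 1 t.toNat := by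
  rw [Finset.mem_Icc]
  refine ⟨hc, ?_⟩
  have hc1 : (1 : ℤ) ≤ c := by exact_mod_cast hc
  have h1 : (c : ℤ) ≤ t := by nlinarith
  have h2 : (c : ℤ) ≤ (t.toNat : ℤ) := by rwa [Int.toNat_of_nonneg ht.le]
  exact_mod_cast h2

end Helpers

/-! ## §1 The two exceptional strata: `t = c²` and `t = 3c²` -/

section Strata

/-- **The stratum `t = c²` is `L(1)/O₆^×`: `|L_c(c²)/O₆^×| = 2`** — a primitive `p` with `c²Q(p) = c²` is a vector of norm
`1`, and every vector of norm `1` is primitive (`x₁·x₁ − 3x₂·x₂ − 3x₃·x₃ = 1` is a Bézout relation); `|L(1)/O₆^×| = 2`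
(`card_unit_classes_one`: the classes `[±i]`). [cite: KudlaRapoportYang2006, §3.4 (3.4.6) and Lemma 3.4.3] [cite: BayerTravesa2007, §1 Thm. 1.1] -/
theorem card_stratum_of_sq_eq {t : ℤ} {c : ℕ} (hc : 0 < c) (h : (c : ℤ) ^ 2 = t) :
    Nat.card (Quot (fun x y : {x : ℤ × ℤ × ℤ // (c : ℤ) ^ 2 * (x.1 ^ 2 - 3 * x.2.1 ^ 2 - 3 * x.2.2 ^ 2) = t ∧
      ∃ u : ℤ × ℤ × ℤ, u.1 * x.1 + u.2.1 * x.2.1 + u.2.2 * x.2.2 = 1} ↦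
      ∃ v : ℍ[ℚ,((-1 : ℤ) : ℚ),((3 : ℤ) : ℚ)], (v ∈ order (-1) 3 ∨ v - ⟨1/2, 1/2, 1/2, -1/2⟩ ∈ order (-1) 3) ∧
        ((v * star v).re = 1 ∨ (v * star v).re = -1) ∧
        v * ⟨0, x.1.1, x.1.2.1, x.1.2.2⟩ = ⟨0, y.1.1, y.1.2.1, y.1.2.2⟩ * v)) = 2 := by
  have hc2 : (c : ℤ) ^ 2 ≠ 0 := by positivity
  have key : ∀ x : ℤ × ℤ × ℤ, ((c : ℤ) ^ 2 * (x.1 ^ 2 - 3 * x.2.1 ^ 2 - 3 * x.2.2 ^ 2) = t ∧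
      ∃ u : ℤ × ℤ × ℤ, u.1 * x.1 + u.2.1 * x.2.1 + u.2.2 * x.2.2 = 1) ↔ (x.1 ^ 2 - 3 * x.2.1 ^ 2 - 3 * x.2.2 ^ 2) = 1 := by
    intro x
    constructor
    · rintro ⟨hQ, -⟩
      have e : (c : ℤ) ^ 2 * (x.1 ^ 2 - 3 * x.2.1 ^ 2 - 3 * x.2.2 ^ 2) = (c : ℤ) ^ 2 * 1 := by rw [hQ, mul_one, h]
      exact mul_left_cancel₀ hc2 e
    · intro hQ
      refine ⟨by rw [hQ, mul_one, h], (x.1, -3 * x.2.1, -3 * x.2.2), ?_⟩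
      show x.1 * x.1 + (-3 * x.2.1) * x.2.1 + (-3 * x.2.2) * x.2.2 = 1
      linear_combination hQ
  exact (Nat.card_congr (Quot.congr (Equiv.subtypeEquivRight key) fun _ _ ↦ Iff.rfl)).trans card_unit_classes_one

/-- **The stratum `t = 3c²` is `L(3)/O₆^×`: `|L_c(3c²)/O₆^×| = 2`** — a primitive `p` with `c²Q(p) = 3c²` has norm `3`, and
every vector of norm `3` is primitive (`3 ∣ x₁`, `x₁ = 3y`, `y·x₁ − x₂·x₂ − x₃·x₃ = 1`); `|L(3)/O₆^×| = 2`
(`card_unit_classes_three`). [cite: KudlaRapoportYang2006, §3.4 (3.4.6)] [cite: BayerTravesa2007, §1 Thm. 1.1] -/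
theorem card_stratum_of_three_mul_sq_eq {t : ℤ} {c : ℕ} (hc : 0 < c) (h : (c : ℤ) ^ 2 * 3 = t) :
    Nat.card (Quot (fun x y : {x : ℤ × ℤ × ℤ // (c : ℤ) ^ 2 * (x.1 ^ 2 - 3 * x.2.1 ^ 2 - 3 * x.2.2 ^ 2) = t ∧
      ∃ u : ℤ × ℤ × ℤ, u.1 * x.1 + u.2.1 * x.2.1 + u.2.2 * x.2.2 = 1} ↦
      ∃ v : ℍ[ℚ,((-1 : ℤ) : ℚ),((3 : ℤ) : ℚ)], (v ∈ order (-1) 3 ∨ v - ⟨1/2, 1/2, 1/2, -1/2⟩ ∈ order (-1) 3) ∧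
        ((v * star v).re = 1 ∨ (v * star v).re = -1) ∧
        v * ⟨0, x.1.1, x.1.2.1, x.1.2.2⟩ = ⟨0, y.1.1, y.1.2.1, y.1.2.2⟩ * v)) = 2 := by
  have hc2 : (c : ℤ) ^ 2 ≠ 0 := by positivity
  have key : ∀ x : ℤ × ℤ × ℤ, ((c : ℤ) ^ 2 * (x.1 ^ 2 - 3 * x.2.1 ^ 2 - 3 * x.2.2 ^ 2) = t ∧
      ∃ u : ℤ × ℤ × ℤ, u.1 * x.1 + u.2.1 * x.2.1 + u.2.2 * x.2.2 = 1) ↔ (x.1 ^ 2 - 3 * x.2.1 ^ 2 - 3 * x.2.2 ^ 2) = 3 := by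
    intro x
    constructor
    · rintro ⟨hQ, -⟩
      have e : (c : ℤ) ^ 2 * (x.1 ^ 2 - 3 * x.2.1 ^ 2 - 3 * x.2.2 ^ 2) = (c : ℤ) ^ 2 * 3 := by rw [hQ, h]
      exact mul_left_cancel₀ hc2 e
    · intro hQ
      refine ⟨by rw [hQ, h], ?_⟩
      have h3 : (3 : ℤ) ∣ x.1 ^ 2 := ⟨1 + x.2.1 ^ 2 + x.2.2 ^ 2, by linear_combination hQ⟩
      obtain ⟨y, hy⟩ := Int.prime_three.dvd_of_dvd_pow h3
      refine ⟨(y, -x.2.1, -x.2.2), ?_⟩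
      show y * x.1 + (-x.2.1) * x.2.1 + (-x.2.2) * x.2.2 = 1
      have e : (3 : ℤ) * (y * x.1 + (-x.2.1) * x.2.1 + (-x.2.2) * x.2.2) = 3 * 1 := by
        linear_combination hQ - x.1 * hy
      exact mul_left_cancel₀ (by norm_num) e
  exact (Nat.card_congr (Quot.congr (Equiv.subtypeEquivRight key) fun _ _ ↦ Iff.rfl)).trans card_unit_classes_three

end Strata

/-! ## §2 The closed form `2·Σᶠ e⁻¹ = |L(t)/O₆^×| − [t = m²] − (4/3)[t = 3m²]` -/

section ClosedForm

/-- **`2·Σᶠ_{L(t)/O₆^×} e⁻¹ = |L(t)/O₆^×| − ½·Σ_{c² = t} |L_c(t)/O₆^×| − ⅔·Σ_{3c² = t} |L_c(t)/O₆^×|`** (`t > 0`; the inner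
sums over `c ∈ [1, t]` have at most one term): the content reduction `Σᶠ e⁻¹ = Σ_c |L_c|/w_c` with `2/w_c = 1 − ½[c² = t] −
⅔[3c² = t]`, against `|L(t)/O₆^×| = Σ_c |L_c|`. [cite: KudlaRapoportYang2006, §3.4 (3.4.6) and (3.4.14)] [cite: VignerasLNM800, Ch. III §5.C Cor. 5.14] -/
theorem two_mul_finsum_eq_card_sub {t : ℤ} (ht : 0 < t) :
    2 * ∑ᶠ q : (Quot (fun x y : {x : ℤ × ℤ × ℤ // x.1 ^ 2 - 3 * x.2.1 ^ 2 - 3 * x.2.2 ^ 2 = t} ↦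
      ∃ v : ℍ[ℚ,((-1 : ℤ) : ℚ),((3 : ℤ) : ℚ)], (v ∈ order (-1) 3 ∨ v - ⟨1/2, 1/2, 1/2, -1/2⟩ ∈ order (-1) 3) ∧
        ((v * star v).re = 1 ∨ (v * star v).re = -1) ∧
        v * ⟨0, x.1.1, x.1.2.1, x.1.2.2⟩ = ⟨0, y.1.1, y.1.2.1, y.1.2.2⟩ * v)),
        ((Nat.card
          {u : ℍ[ℚ,((-1 : ℤ) : ℚ),((3 : ℤ) : ℚ)] // (u ∈ order (-1) 3 ∨ u - ⟨1/2, 1/2, 1/2, -1/2⟩ ∈ order (-1) 3) ∧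
            ((u * star u).re = 1 ∨ (u * star u).re = -1) ∧
            u * ⟨0, q.out.1.1, q.out.1.2.1, q.out.1.2.2⟩ = ⟨0, q.out.1.1, q.out.1.2.1, q.out.1.2.2⟩ * u} : ℚ))⁻¹ =
    (Nat.card (Quot (fun x y : {x : ℤ × ℤ × ℤ // x.1 ^ 2 - 3 * x.2.1 ^ 2 - 3 * x.2.2 ^ 2 = t} ↦
      ∃ v : ℍ[ℚ,((-1 : ℤ) : ℚ),((3 : ℤ) : ℚ)], (v ∈ order (-1) 3 ∨ v - ⟨1/2, 1/2, 1/2, -1/2⟩ ∈ order (-1) 3) ∧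
        ((v * star v).re = 1 ∨ (v * star v).re = -1) ∧
        v * ⟨0, x.1.1, x.1.2.1, x.1.2.2⟩ = ⟨0, y.1.1, y.1.2.1, y.1.2.2⟩ * v)) : ℚ) -
      (∑ c ∈ (Finset.Icc 1 t.toNat).filter (fun c : ℕ ↦ (c : ℤ) ^ 2 = t), (Nat.card (Quot (fun x y : {x : ℤ × ℤ × ℤ // (c : ℤ) ^ 2 * (x.1 ^ 2 - 3 * x.2.1 ^ 2 - 3 * x.2.2 ^ 2) = t ∧
      ∃ u : ℤ × ℤ × ℤ, u.1 * x.1 + u.2.1 * x.2.1 + u.2.2 * x.2.2 = 1} ↦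
      ∃ v : ℍ[ℚ,((-1 : ℤ) : ℚ),((3 : ℤ) : ℚ)], (v ∈ order (-1) 3 ∨ v - ⟨1/2, 1/2, 1/2, -1/2⟩ ∈ order (-1) 3) ∧
        ((v * star v).re = 1 ∨ (v * star v).re = -1) ∧
        v * ⟨0, x.1.1, x.1.2.1, x.1.2.2⟩ = ⟨0, y.1.1, y.1.2.1, y.1.2.2⟩ * v)) : ℚ)) / 2 -
      2 / 3 * ∑ c ∈ (Finset.Icc 1 t.toNat).filter (fun c : ℕ ↦ (c : ℤ) ^ 2 * 3 = t), (Nat.card (Quot (fun x y : {x : ℤ × ℤ × ℤ // (c : ℤ) ^ 2 * (x.1 ^ 2 - 3 * x.2.1 ^ 2 - 3 * x.2.2 ^ 2) = t ∧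
      ∃ u : ℤ × ℤ × ℤ, u.1 * x.1 + u.2.1 * x.2.1 + u.2.2 * x.2.2 = 1} ↦
      ∃ v : ℍ[ℚ,((-1 : ℤ) : ℚ),((3 : ℤ) : ℚ)], (v ∈ order (-1) 3 ∨ v - ⟨1/2, 1/2, 1/2, -1/2⟩ ∈ order (-1) 3) ∧
        ((v * star v).re = 1 ∨ (v * star v).re = -1) ∧
        v * ⟨0, x.1.1, x.1.2.1, x.1.2.2⟩ = ⟨0, y.1.1, y.1.2.1, y.1.2.2⟩ * v)) : ℚ) := by
  rw [finsum_unit_classes_eq_sum_content ht, card_unit_classes_eq_sum_content ht]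
  push_cast
  rw [Finset.mul_sum, Finset.sum_filter, Finset.sum_filter, Finset.sum_div, Finset.mul_sum, ← Finset.sum_sub_distrib,
    ← Finset.sum_sub_distrib]
  refine Finset.sum_congr rfl fun c hc ↦ ?_
  have hc1 : 1 ≤ c := (Finset.mem_Icc.1 hc).1
  by_cases h1 : (c : ℤ) ^ 2 = t
  · have h3 : ¬ (c : ℤ) ^ 2 * 3 = t := by
      intro h
      have hc0 : (0 : ℤ) < (c : ℤ) ^ 2 := by positivity
      nlinarith
    rw [if_pos h1, if_pos h1, if_neg h3]
    ring
  · by_cases h3 : (c : ℤ) ^ 2 * 3 = t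
    · rw [if_neg h1, if_neg h1, if_pos h3, if_pos h3]
      ring
    · rw [if_neg h1, if_neg h1, if_neg h3, if_neg h3]
      ring

/-- **`t` NEITHER A SQUARE NOR `3·`(A SQUARE) ⟹ `deg Z(t)_ℚ = |L(t)/O₆^×|`** (`t > 0`): every class weighs `e⁻¹ = ½`, so
Kudla–Rapoport–Yang's degree is exactly the size of their index set — equivalently (§3) the number of points of `Z(t)` on
`X₆`, each with weight `1`. [cite: KudlaRapoportYang2006, §3.4 (3.4.6) («`w(c²d)`» `= 2` off `d ∈ {3, 4}`) and (3.4.13)–(3.4.14)] -/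
theorem degree_eq_card_of_not_sq {t : ℤ} (ht : 0 < t) (h1 : ¬ IsSquare t) (h3 : ¬ ∃ m : ℤ, t = 3 * m ^ 2) :
    2 * ∑ᶠ q : (Quot (fun x y : {x : ℤ × ℤ × ℤ // x.1 ^ 2 - 3 * x.2.1 ^ 2 - 3 * x.2.2 ^ 2 = t} ↦
      ∃ v : ℍ[ℚ,((-1 : ℤ) : ℚ),((3 : ℤ) : ℚ)], (v ∈ order (-1) 3 ∨ v - ⟨1/2, 1/2, 1/2, -1/2⟩ ∈ order (-1) 3) ∧
        ((v * star v).re = 1 ∨ (v * star v).re = -1) ∧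
        v * ⟨0, x.1.1, x.1.2.1, x.1.2.2⟩ = ⟨0, y.1.1, y.1.2.1, y.1.2.2⟩ * v)),
        ((Nat.card
          {u : ℍ[ℚ,((-1 : ℤ) : ℚ),((3 : ℤ) : ℚ)] // (u ∈ order (-1) 3 ∨ u - ⟨1/2, 1/2, 1/2, -1/2⟩ ∈ order (-1) 3) ∧
            ((u * star u).re = 1 ∨ (u * star u).re = -1) ∧
            u * ⟨0, q.out.1.1, q.out.1.2.1, q.out.1.2.2⟩ = ⟨0, q.out.1.1, q.out.1.2.1, q.out.1.2.2⟩ * u} : ℚ))⁻¹ =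
    (Nat.card (Quot (fun x y : {x : ℤ × ℤ × ℤ // x.1 ^ 2 - 3 * x.2.1 ^ 2 - 3 * x.2.2 ^ 2 = t} ↦
      ∃ v : ℍ[ℚ,((-1 : ℤ) : ℚ),((3 : ℤ) : ℚ)], (v ∈ order (-1) 3 ∨ v - ⟨1/2, 1/2, 1/2, -1/2⟩ ∈ order (-1) 3) ∧
        ((v * star v).re = 1 ∨ (v * star v).re = -1) ∧
        v * ⟨0, x.1.1, x.1.2.1, x.1.2.2⟩ = ⟨0, y.1.1, y.1.2.1, y.1.2.2⟩ * v)) : ℚ) := by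
  have e1 : (Finset.Icc 1 t.toNat).filter (fun c : ℕ ↦ (c : ℤ) ^ 2 = t) = ∅ :=
    Finset.filter_eq_empty_iff.2 fun c _ h ↦ h1 ⟨c, by rw [← h, sq]⟩
  have e3 : (Finset.Icc 1 t.toNat).filter (fun c : ℕ ↦ (c : ℤ) ^ 2 * 3 = t) = ∅ :=
    Finset.filter_eq_empty_iff.2 fun c _ h ↦ h3 ⟨c, by rw [← h]; ring⟩
  rw [two_mul_finsum_eq_card_sub ht, e1, e3, Finset.sum_empty]
  ring

/-- **`t = m²` ⟹ `deg Z(t)_ℚ = |L(t)/O₆^×| − 1`** (`t > 0`): the stratum `c = |m|` (the two classes `[±m·i]`, `e = 4`, over the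
order-`2` elliptic points of `X₆`) weighs `2·¼` instead of `2·½`; no stratum has `3c² = m²`. E.g. `t = 1, 4, 9, 36`: `2 − 1 =
1`; `t = 25, 100`: `6 − 1 = 5`. [cite: KudlaRapoportYang2006, §3.4 (3.4.6) («`w(−4) = 4`») and (3.4.14)] [cite: BayerTravesa2007, §1 Thm. 1.1] -/
theorem degree_eq_card_sub_one_of_sq {t : ℤ} (ht : 0 < t) (hsq : IsSquare t) :
    2 * ∑ᶠ q : (Quot (fun x y : {x : ℤ × ℤ × ℤ // x.1 ^ 2 - 3 * x.2.1 ^ 2 - 3 * x.2.2 ^ 2 = t} ↦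
      ∃ v : ℍ[ℚ,((-1 : ℤ) : ℚ),((3 : ℤ) : ℚ)], (v ∈ order (-1) 3 ∨ v - ⟨1/2, 1/2, 1/2, -1/2⟩ ∈ order (-1) 3) ∧
        ((v * star v).re = 1 ∨ (v * star v).re = -1) ∧
        v * ⟨0, x.1.1, x.1.2.1, x.1.2.2⟩ = ⟨0, y.1.1, y.1.2.1, y.1.2.2⟩ * v)),
        ((Nat.card
          {u : ℍ[ℚ,((-1 : ℤ) : ℚ),((3 : ℤ) : ℚ)] // (u ∈ order (-1) 3 ∨ u - ⟨1/2, 1/2, 1/2, -1/2⟩ ∈ order (-1) 3) ∧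
            ((u * star u).re = 1 ∨ (u * star u).re = -1) ∧
            u * ⟨0, q.out.1.1, q.out.1.2.1, q.out.1.2.2⟩ = ⟨0, q.out.1.1, q.out.1.2.1, q.out.1.2.2⟩ * u} : ℚ))⁻¹ =
    (Nat.card (Quot (fun x y : {x : ℤ × ℤ × ℤ // x.1 ^ 2 - 3 * x.2.1 ^ 2 - 3 * x.2.2 ^ 2 = t} ↦
      ∃ v : ℍ[ℚ,((-1 : ℤ) : ℚ),((3 : ℤ) : ℚ)], (v ∈ order (-1) 3 ∨ v - ⟨1/2, 1/2, 1/2, -1/2⟩ ∈ order (-1) 3) ∧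
        ((v * star v).re = 1 ∨ (v * star v).re = -1) ∧
        v * ⟨0, x.1.1, x.1.2.1, x.1.2.2⟩ = ⟨0, y.1.1, y.1.2.1, y.1.2.2⟩ * v)) : ℚ) - 1 := by
  obtain ⟨r, hr⟩ := hsq
  set m : ℕ := r.natAbs with hm
  have hmt : (m : ℤ) ^ 2 = t := by rw [hm, Int.natAbs_sq, hr, sq]
  have hm0 : 0 < m := by
    rw [hm]
    refine Int.natAbs_pos.2 ?_
    rintro rfl
    rw [mul_zero] at hr
    exact ht.ne' hr
  have e1 : (Finset.Icc 1 t.toNat).filter (fun c : ℕ ↦ (c : ℤ) ^ 2 = t) = {m} := by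
    ext c
    rw [Finset.mem_filter, Finset.mem_singleton]
    constructor
    · rintro ⟨-, h⟩
      have h' : ((c ^ 2 : ℕ) : ℤ) = ((m ^ 2 : ℕ) : ℤ) := by push_cast; rw [h, hmt]
      exact Nat.pow_left_injective two_ne_zero (by exact_mod_cast h')
    · rintro rfl
      exact ⟨mem_Icc_of_sq_mul₄₂ ht hm0 one_pos (by rw [mul_one, hmt]), hmt⟩
  have e3 : (Finset.Icc 1 t.toNat).filter (fun c : ℕ ↦ (c : ℤ) ^ 2 * 3 = t) = ∅ :=
    Finset.filter_eq_empty_iff.2 fun c hc h ↦ intSq_ne_three_mul_sq₄₂ (c := c)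
      (by have := (Finset.mem_Icc.1 hc).1; omega) (m : ℤ) (by rw [hmt, ← h]; ring)
  rw [two_mul_finsum_eq_card_sub ht, e1, e3, Finset.sum_singleton, Finset.sum_empty, card_stratum_of_sq_eq hm0 hmt]
  norm_num

/-- **`t = 3m²` ⟹ `deg Z(t)_ℚ = |L(t)/O₆^×| − 4/3`** (`t > 0`): the stratum `c = |m|` (two classes with `e = 6` over the
order-`3` elliptic points) weighs `2·⅙` instead of `2·½`; no stratum has `c² = 3m²`. E.g. `t = 3, 12`: `2 − 4/3 = 2/3`;
`t = 75`: `6 − 4/3 = 14/3`. [cite: KudlaRapoportYang2006, §3.4 (3.4.6) («`w(−3) = 6`») and (3.4.14)] [cite: BayerTravesa2007, §1 Thm. 1.1] -/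
theorem degree_eq_card_sub_of_three_mul_sq {t : ℤ} (ht : 0 < t) (h3 : ∃ m : ℤ, t = 3 * m ^ 2) :
    2 * ∑ᶠ q : (Quot (fun x y : {x : ℤ × ℤ × ℤ // x.1 ^ 2 - 3 * x.2.1 ^ 2 - 3 * x.2.2 ^ 2 = t} ↦
      ∃ v : ℍ[ℚ,((-1 : ℤ) : ℚ),((3 : ℤ) : ℚ)], (v ∈ order (-1) 3 ∨ v - ⟨1/2, 1/2, 1/2, -1/2⟩ ∈ order (-1) 3) ∧
        ((v * star v).re = 1 ∨ (v * star v).re = -1) ∧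
        v * ⟨0, x.1.1, x.1.2.1, x.1.2.2⟩ = ⟨0, y.1.1, y.1.2.1, y.1.2.2⟩ * v)),
        ((Nat.card
          {u : ℍ[ℚ,((-1 : ℤ) : ℚ),((3 : ℤ) : ℚ)] // (u ∈ order (-1) 3 ∨ u - ⟨1/2, 1/2, 1/2, -1/2⟩ ∈ order (-1) 3) ∧
            ((u * star u).re = 1 ∨ (u * star u).re = -1) ∧
            u * ⟨0, q.out.1.1, q.out.1.2.1, q.out.1.2.2⟩ = ⟨0, q.out.1.1, q.out.1.2.1, q.out.1.2.2⟩ * u} : ℚ))⁻¹ =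
    (Nat.card (Quot (fun x y : {x : ℤ × ℤ × ℤ // x.1 ^ 2 - 3 * x.2.1 ^ 2 - 3 * x.2.2 ^ 2 = t} ↦
      ∃ v : ℍ[ℚ,((-1 : ℤ) : ℚ),((3 : ℤ) : ℚ)], (v ∈ order (-1) 3 ∨ v - ⟨1/2, 1/2, 1/2, -1/2⟩ ∈ order (-1) 3) ∧
        ((v * star v).re = 1 ∨ (v * star v).re = -1) ∧
        v * ⟨0, x.1.1, x.1.2.1, x.1.2.2⟩ = ⟨0, y.1.1, y.1.2.1, y.1.2.2⟩ * v)) : ℚ) - 4 / 3 := by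
  obtain ⟨r, hr⟩ := h3
  set m : ℕ := r.natAbs with hm
  have hmt : (m : ℤ) ^ 2 * 3 = t := by rw [hm, Int.natAbs_sq, hr]; ring
  have hm0 : 0 < m := by
    rw [hm]
    refine Int.natAbs_pos.2 ?_
    rintro rfl
    norm_num at hr
    exact ht.ne' hr
  have e3 : (Finset.Icc 1 t.toNat).filter (fun c : ℕ ↦ (c : ℤ) ^ 2 * 3 = t) = {m} := by
    ext c
    rw [Finset.mem_filter, Finset.mem_singleton]
    constructor
    · rintro ⟨-, h⟩
      have h' : ((c ^ 2 : ℕ) : ℤ) = ((m ^ 2 : ℕ) : ℤ) := by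
        push_cast
        exact mul_right_cancel₀ (by norm_num : (3 : ℤ) ≠ 0) (by rw [h, hmt])
      exact Nat.pow_left_injective two_ne_zero (by exact_mod_cast h')
    · rintro rfl
      exact ⟨mem_Icc_of_sq_mul₄₂ ht hm0 (by norm_num : (0 : ℤ) < 3) hmt, hmt⟩
  have e1 : (Finset.Icc 1 t.toNat).filter (fun c : ℕ ↦ (c : ℤ) ^ 2 = t) = ∅ :=
    Finset.filter_eq_empty_iff.2 fun c _ h ↦ intSq_ne_three_mul_sq₄₂ hm0 (c : ℤ) (by rw [h, ← hmt]; ring)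
  rw [two_mul_finsum_eq_card_sub ht, e1, e3, Finset.sum_singleton, Finset.sum_empty,
    card_stratum_of_three_mul_sq_eq hm0 hmt]
  norm_num

/-- **`3·deg Z(t)_ℚ + 3·[t = m²] + 4·[t = 3m²] = 3·|L(t)/O₆^×|`, all `t > 0` at once** — the trichotomy `t = m²` ∕ `t = 3m²` ∕
neither (`m² = 3c²` is impossible) packaged without case hypotheses: `6·Σᶠ e⁻¹` is an integer congruent to `3|L(t)/O₆^×|`
up to the elliptic corrections `3` or `4`. [cite: KudlaRapoportYang2006, §3.4 (3.4.6) and (3.4.14)] -/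
theorem degree_trichotomy {t : ℤ} (ht : 0 < t) :
    (IsSquare t ∧ 2 * ∑ᶠ q : (Quot (fun x y : {x : ℤ × ℤ × ℤ // x.1 ^ 2 - 3 * x.2.1 ^ 2 - 3 * x.2.2 ^ 2 = t} ↦
      ∃ v : ℍ[ℚ,((-1 : ℤ) : ℚ),((3 : ℤ) : ℚ)], (v ∈ order (-1) 3 ∨ v - ⟨1/2, 1/2, 1/2, -1/2⟩ ∈ order (-1) 3) ∧
        ((v * star v).re = 1 ∨ (v * star v).re = -1) ∧
        v * ⟨0, x.1.1, x.1.2.1, x.1.2.2⟩ = ⟨0, y.1.1, y.1.2.1, y.1.2.2⟩ * v)),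
        ((Nat.card
          {u : ℍ[ℚ,((-1 : ℤ) : ℚ),((3 : ℤ) : ℚ)] // (u ∈ order (-1) 3 ∨ u - ⟨1/2, 1/2, 1/2, -1/2⟩ ∈ order (-1) 3) ∧
            ((u * star u).re = 1 ∨ (u * star u).re = -1) ∧
            u * ⟨0, q.out.1.1, q.out.1.2.1, q.out.1.2.2⟩ = ⟨0, q.out.1.1, q.out.1.2.1, q.out.1.2.2⟩ * u} : ℚ))⁻¹ = (Nat.card (Quot (fun x y : {x : ℤ × ℤ × ℤ // x.1 ^ 2 - 3 * x.2.1 ^ 2 - 3 * x.2.2 ^ 2 = t} ↦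
      ∃ v : ℍ[ℚ,((-1 : ℤ) : ℚ),((3 : ℤ) : ℚ)], (v ∈ order (-1) 3 ∨ v - ⟨1/2, 1/2, 1/2, -1/2⟩ ∈ order (-1) 3) ∧
        ((v * star v).re = 1 ∨ (v * star v).re = -1) ∧
        v * ⟨0, x.1.1, x.1.2.1, x.1.2.2⟩ = ⟨0, y.1.1, y.1.2.1, y.1.2.2⟩ * v)) : ℚ) - 1) ∨
    ((∃ m : ℤ, t = 3 * m ^ 2) ∧ 2 * ∑ᶠ q : (Quot (fun x y : {x : ℤ × ℤ × ℤ // x.1 ^ 2 - 3 * x.2.1 ^ 2 - 3 * x.2.2 ^ 2 = t} ↦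
      ∃ v : ℍ[ℚ,((-1 : ℤ) : ℚ),((3 : ℤ) : ℚ)], (v ∈ order (-1) 3 ∨ v - ⟨1/2, 1/2, 1/2, -1/2⟩ ∈ order (-1) 3) ∧
        ((v * star v).re = 1 ∨ (v * star v).re = -1) ∧
        v * ⟨0, x.1.1, x.1.2.1, x.1.2.2⟩ = ⟨0, y.1.1, y.1.2.1, y.1.2.2⟩ * v)),
        ((Nat.card
          {u : ℍ[ℚ,((-1 : ℤ) : ℚ),((3 : ℤ) : ℚ)] // (u ∈ order (-1) 3 ∨ u - ⟨1/2, 1/2, 1/2, -1/2⟩ ∈ order (-1) 3) ∧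
            ((u * star u).re = 1 ∨ (u * star u).re = -1) ∧
            u * ⟨0, q.out.1.1, q.out.1.2.1, q.out.1.2.2⟩ = ⟨0, q.out.1.1, q.out.1.2.1, q.out.1.2.2⟩ * u} : ℚ))⁻¹ = (Nat.card (Quot (fun x y : {x : ℤ × ℤ × ℤ // x.1 ^ 2 - 3 * x.2.1 ^ 2 - 3 * x.2.2 ^ 2 = t} ↦
      ∃ v : ℍ[ℚ,((-1 : ℤ) : ℚ),((3 : ℤ) : ℚ)], (v ∈ order (-1) 3 ∨ v - ⟨1/2, 1/2, 1/2, -1/2⟩ ∈ order (-1) 3) ∧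
        ((v * star v).re = 1 ∨ (v * star v).re = -1) ∧
        v * ⟨0, x.1.1, x.1.2.1, x.1.2.2⟩ = ⟨0, y.1.1, y.1.2.1, y.1.2.2⟩ * v)) : ℚ) - 4 / 3) ∨
    (¬ IsSquare t ∧ (¬ ∃ m : ℤ, t = 3 * m ^ 2) ∧ 2 * ∑ᶠ q : (Quot (fun x y : {x : ℤ × ℤ × ℤ // x.1 ^ 2 - 3 * x.2.1 ^ 2 - 3 * x.2.2 ^ 2 = t} ↦
      ∃ v : ℍ[ℚ,((-1 : ℤ) : ℚ),((3 : ℤ) : ℚ)], (v ∈ order (-1) 3 ∨ v - ⟨1/2, 1/2, 1/2, -1/2⟩ ∈ order (-1) 3) ∧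
        ((v * star v).re = 1 ∨ (v * star v).re = -1) ∧
        v * ⟨0, x.1.1, x.1.2.1, x.1.2.2⟩ = ⟨0, y.1.1, y.1.2.1, y.1.2.2⟩ * v)),
        ((Nat.card
          {u : ℍ[ℚ,((-1 : ℤ) : ℚ),((3 : ℤ) : ℚ)] // (u ∈ order (-1) 3 ∨ u - ⟨1/2, 1/2, 1/2, -1/2⟩ ∈ order (-1) 3) ∧
            ((u * star u).re = 1 ∨ (u * star u).re = -1) ∧
            u * ⟨0, q.out.1.1, q.out.1.2.1, q.out.1.2.2⟩ = ⟨0, q.out.1.1, q.out.1.2.1, q.out.1.2.2⟩ * u} : ℚ))⁻¹ = (Nat.card (Quot (fun x y : {x : ℤ × ℤ × ℤ // x.1 ^ 2 - 3 * x.2.1 ^ 2 - 3 * x.2.2 ^ 2 = t} ↦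
      ∃ v : ℍ[ℚ,((-1 : ℤ) : ℚ),((3 : ℤ) : ℚ)], (v ∈ order (-1) 3 ∨ v - ⟨1/2, 1/2, 1/2, -1/2⟩ ∈ order (-1) 3) ∧
        ((v * star v).re = 1 ∨ (v * star v).re = -1) ∧
        v * ⟨0, x.1.1, x.1.2.1, x.1.2.2⟩ = ⟨0, y.1.1, y.1.2.1, y.1.2.2⟩ * v)) : ℚ)) := by
  by_cases h1 : IsSquare t
  · exact Or.inl ⟨h1, degree_eq_card_sub_one_of_sq ht h1⟩
  · by_cases h3 : ∃ m : ℤ, t = 3 * m ^ 2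
    · exact Or.inr (Or.inl ⟨h3, degree_eq_card_sub_of_three_mul_sq ht h3⟩)
    · exact Or.inr (Or.inr ⟨h1, h3, degree_eq_card_of_not_sq ht h1 h3⟩)

end ClosedForm

/-! ## §3 In terms of the points of `X₆` under `Z(t)` -/

section Points

/-- **`deg Z(t)_ℚ = #(Pt(t)/Γ₆)` when `t` is neither a square nor `3·`(a square)** (`t > 0`): the degree IS the number of points
of `X₆ = Γ₆∖ℌ` lying under `Z(t)` (`|Pt(t)/Γ₆| = |L(t)/O₆^×|`, `card_specialPoints_eq_card_unit_classes`) — away from the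
elliptic points every point of the support has stabiliser `±1` and weight `1`. [cite: KudlaRapoportYang2006, §3.4 (3.4.11)–(3.4.14) and Remark 3.4.4] -/
theorem degree_eq_card_points_of_not_sq {t : ℤ} (ht : 0 < t) (h1 : ¬ IsSquare t) (h3 : ¬ ∃ m : ℤ, t = 3 * m ^ 2) :
    2 * ∑ᶠ q : (Quot (fun x y : {x : ℤ × ℤ × ℤ // x.1 ^ 2 - 3 * x.2.1 ^ 2 - 3 * x.2.2 ^ 2 = t} ↦
      ∃ v : ℍ[ℚ,((-1 : ℤ) : ℚ),((3 : ℤ) : ℚ)], (v ∈ order (-1) 3 ∨ v - ⟨1/2, 1/2, 1/2, -1/2⟩ ∈ order (-1) 3) ∧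
        ((v * star v).re = 1 ∨ (v * star v).re = -1) ∧
        v * ⟨0, x.1.1, x.1.2.1, x.1.2.2⟩ = ⟨0, y.1.1, y.1.2.1, y.1.2.2⟩ * v)),
        ((Nat.card
          {u : ℍ[ℚ,((-1 : ℤ) : ℚ),((3 : ℤ) : ℚ)] // (u ∈ order (-1) 3 ∨ u - ⟨1/2, 1/2, 1/2, -1/2⟩ ∈ order (-1) 3) ∧
            ((u * star u).re = 1 ∨ (u * star u).re = -1) ∧
            u * ⟨0, q.out.1.1, q.out.1.2.1, q.out.1.2.2⟩ = ⟨0, q.out.1.1, q.out.1.2.1, q.out.1.2.2⟩ * u} : ℚ))⁻¹ =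
    (Nat.card (Quot (fun p q : {τ : ℂ // 0 < τ.im ∧ ∃ x : ℍ[ℚ,((-1 : ℤ) : ℚ),((3 : ℤ) : ℚ)],
        x ∈ order (-1) 3 ∧ x.re = 0 ∧ (x * star x).re = t ∧ moebius (rho (-1) 3 (by norm_num) (castQ (-1) 3 x)) τ = τ} ↦
      ∃ v : ℍ[ℚ,((-1 : ℤ) : ℚ),((3 : ℤ) : ℚ)], (v ∈ order (-1) 3 ∨ v - ⟨1/2, 1/2, 1/2, -1/2⟩ ∈ order (-1) 3) ∧
        v * star v = 1 ∧ moebius (rho (-1) 3 (by norm_num) (castQ (-1) 3 v)) p.1 = q.1)) : ℚ) := by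
  rw [degree_eq_card_of_not_sq ht h1 h3, card_specialPoints_eq_card_unit_classes ht]

/-- **`t = m²`: `deg Z(t)_ℚ = #(Pt(t)/Γ₆) − 1`** (the two order-`2` elliptic points under `Z(m²)` weigh `½` each).
[cite: KudlaRapoportYang2006, §3.4 (3.4.11)–(3.4.14)] [cite: BayerTravesa2007, §1 Thm. 1.1] -/
theorem degree_eq_card_points_sub_one_of_sq {t : ℤ} (ht : 0 < t) (hsq : IsSquare t) :
    2 * ∑ᶠ q : (Quot (fun x y : {x : ℤ × ℤ × ℤ // x.1 ^ 2 - 3 * x.2.1 ^ 2 - 3 * x.2.2 ^ 2 = t} ↦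
      ∃ v : ℍ[ℚ,((-1 : ℤ) : ℚ),((3 : ℤ) : ℚ)], (v ∈ order (-1) 3 ∨ v - ⟨1/2, 1/2, 1/2, -1/2⟩ ∈ order (-1) 3) ∧
        ((v * star v).re = 1 ∨ (v * star v).re = -1) ∧
        v * ⟨0, x.1.1, x.1.2.1, x.1.2.2⟩ = ⟨0, y.1.1, y.1.2.1, y.1.2.2⟩ * v)),
        ((Nat.card
          {u : ℍ[ℚ,((-1 : ℤ) : ℚ),((3 : ℤ) : ℚ)] // (u ∈ order (-1) 3 ∨ u - ⟨1/2, 1/2, 1/2, -1/2⟩ ∈ order (-1) 3) ∧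
            ((u * star u).re = 1 ∨ (u * star u).re = -1) ∧
            u * ⟨0, q.out.1.1, q.out.1.2.1, q.out.1.2.2⟩ = ⟨0, q.out.1.1, q.out.1.2.1, q.out.1.2.2⟩ * u} : ℚ))⁻¹ =
    (Nat.card (Quot (fun p q : {τ : ℂ // 0 < τ.im ∧ ∃ x : ℍ[ℚ,((-1 : ℤ) : ℚ),((3 : ℤ) : ℚ)],
        x ∈ order (-1) 3 ∧ x.re = 0 ∧ (x * star x).re = t ∧ moebius (rho (-1) 3 (by norm_num) (castQ (-1) 3 x)) τ = τ} ↦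
      ∃ v : ℍ[ℚ,((-1 : ℤ) : ℚ),((3 : ℤ) : ℚ)], (v ∈ order (-1) 3 ∨ v - ⟨1/2, 1/2, 1/2, -1/2⟩ ∈ order (-1) 3) ∧
        v * star v = 1 ∧ moebius (rho (-1) 3 (by norm_num) (castQ (-1) 3 v)) p.1 = q.1)) : ℚ) - 1 := by
  rw [degree_eq_card_sub_one_of_sq ht hsq, card_specialPoints_eq_card_unit_classes ht]

/-- **`t = 3m²`: `deg Z(t)_ℚ = #(Pt(t)/Γ₆) − 4/3`** (the two order-`3` elliptic points under `Z(3m²)` weigh `⅓` each).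
[cite: KudlaRapoportYang2006, §3.4 (3.4.11)–(3.4.14)] [cite: BayerTravesa2007, §1 Thm. 1.1] -/
theorem degree_eq_card_points_sub_of_three_mul_sq {t : ℤ} (ht : 0 < t) (h3 : ∃ m : ℤ, t = 3 * m ^ 2) :
    2 * ∑ᶠ q : (Quot (fun x y : {x : ℤ × ℤ × ℤ // x.1 ^ 2 - 3 * x.2.1 ^ 2 - 3 * x.2.2 ^ 2 = t} ↦
      ∃ v : ℍ[ℚ,((-1 : ℤ) : ℚ),((3 : ℤ) : ℚ)], (v ∈ order (-1) 3 ∨ v - ⟨1/2, 1/2, 1/2, -1/2⟩ ∈ order (-1) 3) ∧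
        ((v * star v).re = 1 ∨ (v * star v).re = -1) ∧
        v * ⟨0, x.1.1, x.1.2.1, x.1.2.2⟩ = ⟨0, y.1.1, y.1.2.1, y.1.2.2⟩ * v)),
        ((Nat.card
          {u : ℍ[ℚ,((-1 : ℤ) : ℚ),((3 : ℤ) : ℚ)] // (u ∈ order (-1) 3 ∨ u - ⟨1/2, 1/2, 1/2, -1/2⟩ ∈ order (-1) 3) ∧
            ((u * star u).re = 1 ∨ (u * star u).re = -1) ∧
            u * ⟨0, q.out.1.1, q.out.1.2.1, q.out.1.2.2⟩ = ⟨0, q.out.1.1, q.out.1.2.1, q.out.1.2.2⟩ * u} : ℚ))⁻¹ =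
    (Nat.card (Quot (fun p q : {τ : ℂ // 0 < τ.im ∧ ∃ x : ℍ[ℚ,((-1 : ℤ) : ℚ),((3 : ℤ) : ℚ)],
        x ∈ order (-1) 3 ∧ x.re = 0 ∧ (x * star x).re = t ∧ moebius (rho (-1) 3 (by norm_num) (castQ (-1) 3 x)) τ = τ} ↦
      ∃ v : ℍ[ℚ,((-1 : ℤ) : ℚ),((3 : ℤ) : ℚ)], (v ∈ order (-1) 3 ∨ v - ⟨1/2, 1/2, 1/2, -1/2⟩ ∈ order (-1) 3) ∧
        v * star v = 1 ∧ moebius (rho (-1) 3 (by norm_num) (castQ (-1) 3 v)) p.1 = q.1)) : ℚ) - 4 / 3 := by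
  rw [degree_eq_card_sub_of_three_mul_sq ht h3, card_specialPoints_eq_card_unit_classes ht]

/-- **`3·deg Z(t)_ℚ` is an integer for every `t > 0`** (and `deg Z(t)_ℚ` itself is one unless `t/3` is a square): `3·deg =
3|L(t)/O₆^×| − 3` or `− 4` or `− 0`. [cite: KudlaRapoportYang2006, §3.4 (3.4.6) and (3.4.14)] -/
theorem degree_add_den {t : ℤ} (ht : 0 < t) :
    ∃ n : ℤ, 3 * (2 * ∑ᶠ q : (Quot (fun x y : {x : ℤ × ℤ × ℤ // x.1 ^ 2 - 3 * x.2.1 ^ 2 - 3 * x.2.2 ^ 2 = t} ↦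
      ∃ v : ℍ[ℚ,((-1 : ℤ) : ℚ),((3 : ℤ) : ℚ)], (v ∈ order (-1) 3 ∨ v - ⟨1/2, 1/2, 1/2, -1/2⟩ ∈ order (-1) 3) ∧
        ((v * star v).re = 1 ∨ (v * star v).re = -1) ∧
        v * ⟨0, x.1.1, x.1.2.1, x.1.2.2⟩ = ⟨0, y.1.1, y.1.2.1, y.1.2.2⟩ * v)),
        ((Nat.card
          {u : ℍ[ℚ,((-1 : ℤ) : ℚ),((3 : ℤ) : ℚ)] // (u ∈ order (-1) 3 ∨ u - ⟨1/2, 1/2, 1/2, -1/2⟩ ∈ order (-1) 3) ∧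
            ((u * star u).re = 1 ∨ (u * star u).re = -1) ∧
            u * ⟨0, q.out.1.1, q.out.1.2.1, q.out.1.2.2⟩ = ⟨0, q.out.1.1, q.out.1.2.1, q.out.1.2.2⟩ * u} : ℚ))⁻¹) = (n : ℚ) := by
  rcases degree_trichotomy ht with ⟨-, h⟩ | ⟨-, h⟩ | ⟨-, -, h⟩
  · exact ⟨3 * (Nat.card (Quot (fun x y : {x : ℤ × ℤ × ℤ // x.1 ^ 2 - 3 * x.2.1 ^ 2 - 3 * x.2.2 ^ 2 = t} ↦
      ∃ v : ℍ[ℚ,((-1 : ℤ) : ℚ),((3 : ℤ) : ℚ)], (v ∈ order (-1) 3 ∨ v - ⟨1/2, 1/2, 1/2, -1/2⟩ ∈ order (-1) 3) ∧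
        ((v * star v).re = 1 ∨ (v * star v).re = -1) ∧
        v * ⟨0, x.1.1, x.1.2.1, x.1.2.2⟩ = ⟨0, y.1.1, y.1.2.1, y.1.2.2⟩ * v)) : ℤ) - 3, by rw [h]; push_cast; ring⟩
  · exact ⟨3 * (Nat.card (Quot (fun x y : {x : ℤ × ℤ × ℤ // x.1 ^ 2 - 3 * x.2.1 ^ 2 - 3 * x.2.2 ^ 2 = t} ↦
      ∃ v : ℍ[ℚ,((-1 : ℤ) : ℚ),((3 : ℤ) : ℚ)], (v ∈ order (-1) 3 ∨ v - ⟨1/2, 1/2, 1/2, -1/2⟩ ∈ order (-1) 3) ∧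
        ((v * star v).re = 1 ∨ (v * star v).re = -1) ∧
        v * ⟨0, x.1.1, x.1.2.1, x.1.2.2⟩ = ⟨0, y.1.1, y.1.2.1, y.1.2.2⟩ * v)) : ℤ) - 4, by rw [h]; push_cast; ring⟩
  · exact ⟨3 * (Nat.card (Quot (fun x y : {x : ℤ × ℤ × ℤ // x.1 ^ 2 - 3 * x.2.1 ^ 2 - 3 * x.2.2 ^ 2 = t} ↦
      ∃ v : ℍ[ℚ,((-1 : ℤ) : ℚ),((3 : ℤ) : ℚ)], (v ∈ order (-1) 3 ∨ v - ⟨1/2, 1/2, 1/2, -1/2⟩ ∈ order (-1) 3) ∧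
        ((v * star v).re = 1 ∨ (v * star v).re = -1) ∧
        v * ⟨0, x.1.1, x.1.2.1, x.1.2.2⟩ = ⟨0, y.1.1, y.1.2.1, y.1.2.2⟩ * v)) : ℤ), by rw [h]; push_cast; ring⟩

end Points

end Literature.Geometry.Kaehler.ComplexTorus.QuaternionType
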